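import Literature.MathematicalPhysics.QuantumLattice.FermiRG.Mastropietro2008Ch13FlowProof
import HarnessLib

/-!
# Mastropietro (2005), §5.2 Lemma 4 «vanishing of the reference model beta function» — the ARITHMETIC of the
# proof, (5.78d)–(5.79a)–(5.78k) ⇒ (ind) ⇒ (ind 1) ⇒ (jgvvs) ⇒ contradiction, PROVED for abstract coefficient flows:
# a flow whose Taylor coefficients stay bounded at every scale has vanishing scale-invariant Beta coefficients

V. Mastropietro, *Rigorous proof of Luttinger liquid behavior in the 1d Hubbard model*, J. Stat. Phys. **121** (2005)
373–432, arXiv:cond-mat/0502415 [Mastropietro2005], held as `paper:arxiv-cond-mat_0502415`; locators `p00NN:Lnn` =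
chunk:line of that TeX render (20 chunks; NOT printed pages), TeX labels `\Eq(…)` quoted as printed — the conventions of
the statement file `FermiRG/Mastropietro2005.lean` (typer-wave file F8a of cell `gate-hubbard-kl`; this lemma is its
optional DAG row `Mas05.L4`, listed there under «Lemmas 3–6 … NOT typed»).  Book form: [Mastropietro2008] Ch. 13,
(13.41)–(13.42) p0203 («We will prove that `b^α_{n₁,n₂,n₃} = 0` (13.42) and this implies Lemma 13.1»; the book does
not reprint the argument below).  Theorem-only companion in the pattern of `Mastropietro2005CountertermProof.lean`
(Lemma 2) and `Mastropietro2008Ch13FlowProof.lean` (Lemma 1 = Lemma 13.2): `d = 1` METHODOLOGY; nothing here concerns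
the 2D Hubbard model, and nothing asserts or denies anything about superconductivity.

## Source, quoted (render chunk p0013)

* L36–48: "The Beta function is an analytic function of `v⃗^L_j` and it can be written as, if `α = (o,2),(p,2),4`,
  `β̃^α_j(v⃗^L_j,…,v⃗^L_j) = Σ_{n₁,n₂,n₃} b^α_{j,n₁,n₂,n₃} (g̃^o_{2,j})^{n₁}(g̃^p_{2,j})^{n₂}(g̃_{4,j})^{n₃}`.  We define
  `n ≡ n₁+n₂+n₃` and `n⃗ = (n₁,n₂,n₃)`.  Note that `b^α_{j,n₁,n₂,n₃} = b^α_{n₁,n₂,n₃} + O(γ^{θj})`" (L49–65: scale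
  covariance of the trees plus the short memory property, `0 < θ < 1`).
* **Lemma 4** L69–72: "Assume that Lemma 3 holds; then for any `(n₁,n₂,n₃)`, `b^α_{n₁,n₂,n₃} = 0` `\Eq(1f)`."
  (Lemma 3, p0012:L153–160: for `ḡ = max(|g₂ᵒ|,|g₂ᵖ|,|g₄|)` small, `|g̃^o_{2,j} - g₂ᵒ| ≤ Cḡ²`, `|g̃^p_{2,j} - g₂ᵖ| ≤ Cḡ²`,
  `|g̃_{4,j} - g₄| ≤ Cḡ²` for every `j ≤ 0`; with Theorem 3, "`v⃗^L_j` are analytic functions of `v⃗₁ = (g₂ᵒ,g₂ᵖ,g₄)`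
  around `(0,0,0)`", p0013:L1–3.)
* Proof, L74–117.  "The proof is by contradiction; assume that, for some `n̄⃗` … `β⃗_j(v⃗^L_h,…,v⃗^L_h) =
  b⃗_{j,n̄⃗}(g̃^o_{2,j})^{n̄₁}(g̃^p_{2,j})^{n̄₂}(g̃_{4,j})^{n̄₃} + O(v⃗^L_j)^{n̄+1}` `\Eq(5.60z)` with `b⃗_{n̄⃗}` a non vanishing
  vector, and that for all `n₁+n₂+n₃ = n ≤ n̄-1`, `b⃗_{n⃗}` is vanishing.  From Theorem 3 and Lemma 3 … `v⃗^L_j = v⃗₁ +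
  Σ_{n≤n̄} c⃗^{(j)}_{n⃗}(g₂ᵒ)^{n₁}(g₂ᵖ)^{n₂}(g₄)^{n₃} + O((v⃗^L₁)^{n̄+1})` `\Eq(5.78c)` and for any fixed `j` the sequence
  `c⃗^j_{n⃗}` is a bounded sequence.  Inserting (5.78c) in the Beta function, using analyticity and equating the
  coefficient[s] … with `n ≤ n̄-1` we get `c⃗^{(j-1)}_{n⃗} = c⃗^{(j)}_{n⃗} + Σ_{k=j+1}^{0} d⃗^{n⃗}_{j,k} + O(γ^{θj})`
  `\Eq(5.78d)`, where the last sum represents the contribution of `D⃗_{j,k}` [the short-memory differences `\equ(f22ww)`,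
  p0013:L27–31], so that `|d⃗^{n⃗}_{j,k}| ≤ γ^{-θ(k-j)} D_{n̄} sup_{2≤m≤n-1}|c⃗^{(j)}_{m⃗} - c⃗^{(k)}_{m⃗}|` `\Eq(5.79a)`,
  where we have used that `D⃗_{j,k}` is at least quadratic in the running coupling constants, and `D_{n̄}` is a
  suitable constant (in `j`).  Note that `|c⃗^{(j-1)}_{n⃗} - c⃗_{n⃗}| ≤ D̄_{n̄} Σ_{j'=-∞}^{j}[Σ_{k=j'+1}^{0} γ^{-θ(k-j')}
  sup_{2≤m≤n-1}|c⃗^{(j')}_{m⃗} - c⃗^{(k)}_{m⃗}| + γ^{θj'}]` `\Eq(5.78k)`.  The above inequality implies by induction that,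
  for `n ≤ n̄-1`, `sup_{2≤m≤n}|c⃗^{(k)}_{m⃗} - c⃗_{m⃗}| ≤ Cⁿγ^{θk/2}` `\Eq(ind)` … [`\Eq(5.78l)`: the double geometric sum
  `Σ_{j'≤j}[Σ_{k>j'}γ^{-θ(k-j')}(γ^{θk/2} + γ^{θj'/2}) + γ^{θj'}] ≤ Kγ^{θ(j-1)/2}`].  On the other hand (ind) implies
  `|d⃗^{n̄⃗}_{j,k}| ≤ C̄ⁿγ^{θ(j-1)/2}` `\Eq(ind 1)`.  Writing now the analogous of (5.78d) for `n = n̄` we get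
  `c⃗^{(j-1)}_{n̄⃗} = c⃗^{(j)}_{n̄⃗} + b⃗_{j,n̄⃗} + d⃗^{n̄⃗}_{j,k}`, which can be rewritten as `c⃗^{(j-1)}_{n̄⃗} = c⃗^{(j)}_{n̄⃗} +
  b⃗_{n̄⃗} + O(γ^{θj/2})` `\Eq(jgvvs)`, so that `c⃗^{(j)}_{n̄⃗}` is necessarily … diverging as `j → [-]∞`, and this is a
  contradiction."

## What is proved here, and how it is typed

Read the flow DOWNWARDS, `n = -j ∈ ℕ` (scale `j - 1` is `n + 1`); `γ^{-θ(k-j)} = ρ^{n-k'}` and `γ^{θj} = ρⁿ` with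
`ρ = γ^{-θ} ∈ [0,1)`, written `ρ = σ²` so that the printed rate `γ^{θk/2}` of `\Eq(ind)` is `σ^{k'}`.  The Taylor
coefficients are grouped BY TOTAL DEGREE («level» `m = n₁+n₂+n₃`): `c m n : E m` is the family `(c⃗^{(j)}_{n⃗})_{|n⃗|=m}`
at scale `j = -n`, an element of ANY real normed space `E m` (print: finitely many vectors of `ℝ³`, in the sup norm —
the sup over `|m⃗| ≤ n-1` of `\Eq(5.79a)`); the bound `\Eq(5.79a)` summed over `k` is typed with the SUM over the lower
levels `Σ_{m'<m}‖c m' n - c m' k‖` in place of print's `sup_{2≤m'≤n-1}` — a WEAKER hypothesis (the sup is at most the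
sum), so each theorem below implies its `sup`-form.  Constants `D` (print `D_{n̄}`, `D̄_{n̄}`) and `A` (the `O(γ^{θj})`)
are free nonnegative reals.  Then:

* §A `norm_sub_sub_nsmul_le_sum`, `eq_zero_of_bounded_drift` — the last sentence of the proof: a sequence with
  `‖x_{n+1} - x_n - b‖` summable stays within a bounded distance of `x₀ + n·b`, so if it is bounded then `b = 0`
  (`\Eq(jgvvs)` ⇒ "diverging … contradiction").
* §B `shortMemoryRHS_le`, `coeff_cauchy_of_shortMemory` — `\Eq(5.78d)`+`\Eq(5.79a)` ⇒ `\Eq(ind)`, by the printed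
  induction on the level with the geometric double sum `\Eq(5.78l)` (here `Σ_{k<n}(σ²)^{n-k}σ^k ≤ (1-σ)⁻¹σⁿ`, the sibling
  file's `Mastropietro2008.sum_sqWeight_pow_le`), in CAUCHY form `‖c m n - c m k‖ ≤ Kσ^k` (`k ≤ n`) so that no limit
  `c⃗_{m⃗}` is presupposed; `coeff_limit_of_shortMemory` then gives print's literal `\Eq(ind)` — the limits
  `c⃗_{m⃗} = lim_{j→-∞} c⃗^{(j)}_{m⃗}` exist and `‖c⃗^{(k)}_{m⃗} - c⃗_{m⃗}‖ ≤ K'γ^{θk/2}` — in complete spaces; and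
  `exists_limit_of_geometric_cauchy` is the preamble's "`b_j - b_k = O(γ^{θj})` … taking the limit `k → -∞` we get
  `b_j = b + O(γ^{θj})`" (p0013:L63–65) for any geometrically Cauchy sequence.
* §C `betaCoeff_eq_zero_of_bounded_flow` — THE STEP OF LEMMA 4: if the levels `m < M` obey `\Eq(5.78d)` (no drift:
  "`b⃗_{n⃗}` is vanishing" for `n ≤ n̄-1`), level `M` obeys it with the drift `b = b⃗_{n̄⃗}` (`\Eq(5.78d)` at `n = n̄`
  with `b_{j,n̄} = b_{n̄} + O(γ^{θj})`), and `‖c M n‖` is bounded uniformly in the scale (Lemma 3 with Theorem 3), then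
  `b = 0` — via `\Eq(ind 1)` (`shortMemoryRHS_le`) and §A.
* §D `lemma4_betaCoeff_eq_zero` — Lemma 4's conclusion «`b⃗_{n⃗} = 0` for every `n⃗`» by strong induction on the
  level (print's "assume … for some `n̄` … and for all `n ≤ n̄-1` vanishing" = least counterexample), from the
  hypothesis SCHEMA the model supplies: at each level `M`, IF the lower Beta coefficients vanish THEN the level-`M`
  coefficients obey `\Eq(5.78d)` with drift `b M` (level-dependent constants allowed), plus uniform boundedness.

What stays GAP (cell GAP-LEDGER G-t8-1; no object in the tree): that the reference model `\equ(ll)` (p0012:L93–105)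
DELIVERS these inputs — the expansion (5.78c) and its analyticity (Theorem 3), the boundedness of the flow (Lemma 3,
proved in §6 by Ward identities), the scale covariance `b_{j,n⃗} = b_{n⃗} + O(γ^{θj})`, and the quadratic short-memory
structure `\Eq(5.79a)` of `D⃗_{j,k}`; and §5.3 (the comparison with the Hubbard Beta function that yields Theorem 4 =
[Mastropietro2008, Lemma 13.1]).  No definitions, no `sorry`, no new named fact (net fact debt 0); `U`, `μ` do not occur
(the lemma is about the reference model's couplings `(g₂ᵒ, g₂ᵖ, g₄)`).
-/

noncomputable section

open Finset Filter Topology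

namespace Literature.MathematicalPhysics.QuantumLattice.FermiRG

namespace Mastropietro2005

/-! ## §A. `\Eq(jgvvs)` ⇒ contradiction: a bounded sequence has no drift -/

/-- `Mas05.L4`, last step · **Telescoping with a drift.**  If `‖x_{n+1} - x_n - b‖ ≤ e_n` for every `n`, then
`‖x_n - x_0 - n·b‖ ≤ Σ_{k<n} e_k` (print: iterating `\Eq(jgvvs)` `c⃗^{(j-1)}_{n̄⃗} = c⃗^{(j)}_{n̄⃗} + b⃗_{n̄⃗} + O(γ^{θj/2})`
down from scale `0`). [cite: Mastropietro2005, §5.2 proof of Lemma 4, \Eq(jgvvs) (p0013:L104-117)] -/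
theorem norm_sub_sub_nsmul_le_sum {E : Type*} [SeminormedAddCommGroup E] (x : ℕ → E) (b : E)
    (e : ℕ → ℝ) (h : ∀ n, ‖x (n + 1) - x n - b‖ ≤ e n) (n : ℕ) :
    ‖x n - x 0 - n • b‖ ≤ ∑ k ∈ range n, e k := by
  induction n with
  | zero => simp
  | succ n ih =>
    rw [Finset.sum_range_succ, succ_nsmul]
    calc ‖x (n + 1) - x 0 - (n • b + b)‖
        = ‖(x (n + 1) - x n - b) + (x n - x 0 - n • b)‖ := by congr 1; abel
      _ ≤ ‖x (n + 1) - x n - b‖ + ‖x n - x 0 - n • b‖ := norm_add_le _ _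
      _ ≤ e n + ∑ k ∈ range n, e k := add_le_add (h n) ih
      _ = ∑ k ∈ range n, e k + e n := add_comm _ _

/-- `Mas05.L4`, last step · **"so that `c⃗^{(j)}_{n̄⃗}` is necessarily diverging as `j → -∞`, and this is a
contradiction"** (p0013:L116–117), as a positive statement: in a real normed space, a sequence `x` with
`‖x_{n+1} - x_n - b‖ ≤ e_n`, `Σ_{k<n} e_k ≤ S` for all `n`, and `‖x_n‖ ≤ B` for all `n`, has `b = 0` (for `b ≠ 0`,
`n‖b‖ ≤ ‖x_n‖ + ‖x_0‖ + S ≤ 2B + S` fails for `n` large).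
[cite: Mastropietro2005, §5.2 proof of Lemma 4, \Eq(jgvvs) (p0013:L104-117)] -/
theorem eq_zero_of_bounded_drift {E : Type*} [NormedAddCommGroup E] [NormedSpace ℝ E]
    (x : ℕ → E) (b : E) (e : ℕ → ℝ) {S B : ℝ}
    (h : ∀ n, ‖x (n + 1) - x n - b‖ ≤ e n) (hS : ∀ n, ∑ k ∈ range n, e k ≤ S)
    (hB : ∀ n, ‖x n‖ ≤ B) : b = 0 := by
  by_contra hb
  have hb' : 0 < ‖b‖ := norm_pos_iff.2 hb
  have key : ∀ n : ℕ, (n : ℝ) * ‖b‖ ≤ S + 2 * B := by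
    intro n
    have h1 : ‖n • b‖ = (n : ℝ) * ‖b‖ := by
      rw [← Nat.cast_smul_eq_nsmul ℝ n b, norm_smul, Real.norm_natCast]
    have h2 : n • b = (x n - x 0) - (x n - x 0 - n • b) := by abel
    have h3 : ‖n • b‖ ≤ ‖x n‖ + ‖x 0‖ + ‖x n - x 0 - n • b‖ :=
      calc ‖n • b‖ = ‖(x n - x 0) - (x n - x 0 - n • b)‖ := congrArg _ h2
        _ ≤ ‖x n - x 0‖ + ‖x n - x 0 - n • b‖ := norm_sub_le _ _
        _ ≤ (‖x n‖ + ‖x 0‖) + ‖x n - x 0 - n • b‖ := by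
            gcongr; exact norm_sub_le _ _
    have h4 := norm_sub_sub_nsmul_le_sum x b e h n
    linarith [hS n, hB n, hB 0]
  obtain ⟨n, hn⟩ := exists_nat_gt ((S + 2 * B) / ‖b‖)
  have h5 := key n
  rw [div_lt_iff₀ hb'] at hn
  linarith

/-! ## §B. `\Eq(5.78d)` + `\Eq(5.79a)` ⇒ `\Eq(ind)`: the lower-order coefficients converge at rate `γ^{θk/2}`

The coefficient families `c m n : E m` (level `m` = total degree, scale `j = -n`); all levels `m < M` obey the
printed recursion WITHOUT drift: `‖c m (n+1) - c m n‖ ≤ D·Σ_{k<n}(σ²)^{n-k}·Σ_{m'<m}‖c m' n - c m' k‖ + A·(σ²)ⁿ`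
(`\Eq(5.78d)` with `\Eq(5.79a)` inserted and summed over `k = j+1,…,0`; `σ² = γ^{-θ}`). -/

section Cauchy

variable {E : ℕ → Type*} [∀ m, SeminormedAddCommGroup (E m)]

/-- `Mas05.L4` `\Eq(ind)` ⇒ `\Eq(ind 1)` / the inner estimate of `\Eq(5.78l)` · **The short-memory right side against a
geometric Cauchy bound of the lower levels.**  If every level `m < M` satisfies `‖c m n - c m k‖ ≤ Kσ^k` for `k ≤ n`
(the Cauchy form of `\Eq(ind)`), then for every scale `n`
`D·Σ_{k<n}(σ²)^{n-k}·Σ_{m<M}‖c m n - c m k‖ + A·(σ²)ⁿ ≤ (D·M·K·(1-σ)⁻¹ + A)·σⁿ` — print's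
`Σ_{k>j'}γ^{-θ(k-j')}γ^{θk/2} ≤ const·γ^{θj'/2}`, here via `Σ_{k<n}(σ²)^{n-k}σ^k ≤ (1-σ)⁻¹σⁿ`
(`Mastropietro2008.sum_sqWeight_pow_le`) and `(σ²)ⁿ ≤ σⁿ`.
[cite: Mastropietro2005, §5.2 proof of Lemma 4, \Eq(5.79a), \Eq(5.78l), \Eq(ind 1) (p0013:L99-121)] -/
theorem shortMemoryRHS_le (c : (m : ℕ) → ℕ → E m) {σ D A K : ℝ} (hσ0 : 0 ≤ σ) (hσ1 : σ < 1)
    (hD : 0 ≤ D) (hA : 0 ≤ A) (hK : 0 ≤ K) {M : ℕ}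
    (hlow : ∀ m < M, ∀ k n : ℕ, k ≤ n → ‖c m n - c m k‖ ≤ K * σ ^ k) (n : ℕ) :
    D * ∑ k ∈ range n, (σ ^ 2) ^ (n - k) * ∑ m ∈ range M, ‖c m n - c m k‖ + A * (σ ^ 2) ^ n
      ≤ (D * (M * K) * (1 - σ)⁻¹ + A) * σ ^ n := by
  have h1σ : 0 < 1 - σ := by linarith
  have hin : ∀ k ∈ range n, ∑ m ∈ range M, ‖c m n - c m k‖ ≤ M * K * σ ^ k := by
    intro k hk
    have hkn : k ≤ n := (Finset.mem_range.1 hk).le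
    have h := Finset.sum_le_sum fun m hm => hlow m (Finset.mem_range.1 hm) k n hkn
    rw [Finset.sum_const, Finset.card_range, nsmul_eq_mul] at h
    linarith
  have hgeo : ∑ k ∈ range n, (σ ^ 2) ^ (n - k) * σ ^ k ≤ (1 - σ)⁻¹ * σ ^ n :=
    Mastropietro2008.sum_sqWeight_pow_le hσ0 hσ1 n
  have hMK : 0 ≤ (M : ℝ) * K := mul_nonneg (Nat.cast_nonneg M) hK
  have h1 : ∑ k ∈ range n, (σ ^ 2) ^ (n - k) * ∑ m ∈ range M, ‖c m n - c m k‖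
      ≤ M * K * ((1 - σ)⁻¹ * σ ^ n) :=
    calc ∑ k ∈ range n, (σ ^ 2) ^ (n - k) * ∑ m ∈ range M, ‖c m n - c m k‖
        ≤ ∑ k ∈ range n, (σ ^ 2) ^ (n - k) * (M * K * σ ^ k) :=
          Finset.sum_le_sum fun k hk =>
            mul_le_mul_of_nonneg_left (hin k hk) (pow_nonneg (sq_nonneg σ) _)
      _ = M * K * ∑ k ∈ range n, (σ ^ 2) ^ (n - k) * σ ^ k := by
          rw [Finset.mul_sum]
          exact Finset.sum_congr rfl fun k _ => by ring
      _ ≤ M * K * ((1 - σ)⁻¹ * σ ^ n) := mul_le_mul_of_nonneg_left hgeo hMK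
  have h2 : (σ ^ 2) ^ n ≤ σ ^ n := by
    rw [sq, mul_pow]
    exact mul_le_of_le_one_right (pow_nonneg hσ0 n) (pow_le_one₀ hσ0 hσ1.le)
  calc D * ∑ k ∈ range n, (σ ^ 2) ^ (n - k) * ∑ m ∈ range M, ‖c m n - c m k‖ + A * (σ ^ 2) ^ n
      ≤ D * (M * K * ((1 - σ)⁻¹ * σ ^ n)) + A * σ ^ n :=
        add_le_add (mul_le_mul_of_nonneg_left h1 hD) (mul_le_mul_of_nonneg_left h2 hA)
    _ = (D * (M * K) * (1 - σ)⁻¹ + A) * σ ^ n := by ring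

/-- `Mas05.L4` `\Eq(5.78d)`+`\Eq(5.79a)` ⇒ `\Eq(ind)` · **The induction `\Eq(5.78k)`–`\Eq(5.78l)`, closed over all
scales, in Cauchy form.**  If every level `m < M` of the coefficient flow obeys the driftless recursion
`‖c m (n+1) - c m n‖ ≤ D·Σ_{k<n}(σ²)^{n-k}·Σ_{m'<m}‖c m' n - c m' k‖ + A·(σ²)ⁿ` (`0 ≤ σ < 1`, `D, A ≥ 0`), then there
is `K ≥ 0` with `‖c m n - c m k‖ ≤ K·σ^k` for all `m < M` and all scales `k ≤ n` — print's "`sup_{2≤m≤n}|c⃗^{(k)}_{m⃗} -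
c⃗_{m⃗}| ≤ Cⁿγ^{θk/2}` … by induction … (ind) holds for `j-1` if `C ≥ KD̄_{n̄}`", with the constant built level by
level (`K ↦ K + (D·M·K·(1-σ)⁻¹ + A)(1-σ)⁻¹`: the level-`M` steps are `≤ K₁σⁿ` by `shortMemoryRHS_le`, and
`Σ_{k≤i<n}σ^i ≤ σ^k(1-σ)⁻¹`). [cite: Mastropietro2005, §5.2 proof of Lemma 4, \Eq(5.78d), \Eq(5.79a), \Eq(5.78k), \Eq(ind), \Eq(5.78l) (p0013:L94-119)] -/
theorem coeff_cauchy_of_shortMemory (c : (m : ℕ) → ℕ → E m) {σ D A : ℝ} (hσ0 : 0 ≤ σ)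
    (hσ1 : σ < 1) (hD : 0 ≤ D) (hA : 0 ≤ A) {M : ℕ}
    (hrec : ∀ m < M, ∀ n, ‖c m (n + 1) - c m n‖ ≤
      D * ∑ k ∈ range n, (σ ^ 2) ^ (n - k) * ∑ m' ∈ range m, ‖c m' n - c m' k‖ +
        A * (σ ^ 2) ^ n) :
    ∃ K, 0 ≤ K ∧ ∀ m < M, ∀ k n : ℕ, k ≤ n → ‖c m n - c m k‖ ≤ K * σ ^ k := by
  have h1σ : 0 < 1 - σ := by linarith
  induction M with
  | zero => exact ⟨0, le_rfl, fun m hm => absurd hm (Nat.not_lt_zero m)⟩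
  | succ M ih =>
    obtain ⟨K, hK, hlow⟩ := ih fun m hm => hrec m (Nat.lt_succ_of_lt hm)
    have hK₁0 : 0 ≤ D * (M * K) * (1 - σ)⁻¹ + A :=
      add_nonneg (mul_nonneg (mul_nonneg hD (mul_nonneg (Nat.cast_nonneg M) hK))
        (inv_nonneg.2 h1σ.le)) hA
    -- the level-`M` one-step bound, `\Eq(5.78l)`
    have hstep : ∀ n, ‖c M (n + 1) - c M n‖ ≤ (D * (M * K) * (1 - σ)⁻¹ + A) * σ ^ n := fun n =>
      (hrec M (Nat.lt_succ_self M) n).trans (shortMemoryRHS_le c hσ0 hσ1 hD hA hK hlow n)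
    -- summed: the Cauchy bound at level `M`
    have hM : ∀ k n : ℕ, k ≤ n →
        ‖c M n - c M k‖ ≤ (D * (M * K) * (1 - σ)⁻¹ + A) * (1 - σ)⁻¹ * σ ^ k := by
      intro k n hkn
      have h1 : dist (c M k) (c M n) ≤ ∑ i ∈ Ico k n, dist (c M i) (c M (i + 1)) :=
        dist_le_Ico_sum_dist (fun i => c M i) hkn
      have h2 : ∑ i ∈ Ico k n, dist (c M i) (c M (i + 1)) ≤
          ∑ i ∈ Ico k n, (D * (M * K) * (1 - σ)⁻¹ + A) * σ ^ i :=
        Finset.sum_le_sum fun i _ => by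
          rw [dist_comm, dist_eq_norm]
          exact hstep i
      have h3 : ∑ i ∈ Ico k n, (D * (M * K) * (1 - σ)⁻¹ + A) * σ ^ i ≤
          (D * (M * K) * (1 - σ)⁻¹ + A) * (σ ^ k / (1 - σ)) := by
        rw [← Finset.mul_sum]
        exact mul_le_mul_of_nonneg_left (geom_sum_Ico_le_of_lt_one hσ0 hσ1) hK₁0
      rw [← dist_eq_norm, dist_comm]
      calc dist (c M k) (c M n) ≤ (D * (M * K) * (1 - σ)⁻¹ + A) * (σ ^ k / (1 - σ)) :=
            h1.trans (h2.trans h3)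
        _ = (D * (M * K) * (1 - σ)⁻¹ + A) * (1 - σ)⁻¹ * σ ^ k := by ring
    refine ⟨K + (D * (M * K) * (1 - σ)⁻¹ + A) * (1 - σ)⁻¹,
      add_nonneg hK (mul_nonneg hK₁0 (inv_nonneg.2 h1σ.le)), fun m hm k n hkn => ?_⟩
    have hσk : 0 ≤ σ ^ k := pow_nonneg hσ0 k
    rcases Nat.lt_succ_iff_lt_or_eq.1 hm with hm' | rfl
    · calc ‖c m n - c m k‖ ≤ K * σ ^ k := hlow m hm' k n hkn
        _ ≤ (K + (D * (M * K) * (1 - σ)⁻¹ + A) * (1 - σ)⁻¹) * σ ^ k :=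
            mul_le_mul_of_nonneg_right (le_add_of_nonneg_right
              (mul_nonneg hK₁0 (inv_nonneg.2 h1σ.le))) hσk
    · calc ‖c m n - c m k‖ ≤ (D * (m * K) * (1 - σ)⁻¹ + A) * (1 - σ)⁻¹ * σ ^ k := hM k n hkn
        _ ≤ (K + (D * (m * K) * (1 - σ)⁻¹ + A) * (1 - σ)⁻¹) * σ ^ k :=
            mul_le_mul_of_nonneg_right (le_add_of_nonneg_left hK) hσk

/-- `Mas05.L4` `\Eq(ind)`, literal form · **The lower-order coefficients CONVERGE as `j → -∞`, at rate `γ^{θk/2}`.**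
In complete spaces the Cauchy bound of `coeff_cauchy_of_shortMemory` yields, for every level `m < M`, a limit
`c⃗_{m⃗} = lim_{j→-∞} c⃗^{(j)}_{m⃗}` with `‖c⃗^{(k)}_{m⃗} - c⃗_{m⃗}‖ ≤ K'γ^{θk/2}` (`K' = K(1-σ)⁻¹`) — print's `\Eq(ind)`
"`sup_{2≤m≤n}|c⃗^{(k)}_{m⃗} - c⃗_{m⃗}| ≤ Cⁿγ^{θk/2}`", whose `c⃗_{m⃗}` (p0013:L104) is this limit.
[cite: Mastropietro2005, §5.2 proof of Lemma 4, \Eq(ind) (p0013:L110-112)] -/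
theorem coeff_limit_of_shortMemory [∀ m, CompleteSpace (E m)] (c : (m : ℕ) → ℕ → E m)
    {σ D A : ℝ} (hσ0 : 0 ≤ σ) (hσ1 : σ < 1) (hD : 0 ≤ D) (hA : 0 ≤ A) {M : ℕ}
    (hrec : ∀ m < M, ∀ n, ‖c m (n + 1) - c m n‖ ≤
      D * ∑ k ∈ range n, (σ ^ 2) ^ (n - k) * ∑ m' ∈ range m, ‖c m' n - c m' k‖ +
        A * (σ ^ 2) ^ n) :
    ∃ K, 0 ≤ K ∧ ∀ m < M, ∃ cinf : E m,
      Tendsto (c m) atTop (𝓝 cinf) ∧ ∀ n, ‖c m n - cinf‖ ≤ K * σ ^ n := by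
  have h1σ : 0 < 1 - σ := by linarith
  obtain ⟨K, hK, hcau⟩ := coeff_cauchy_of_shortMemory c hσ0 hσ1 hD hA hrec
  refine ⟨K / (1 - σ), div_nonneg hK h1σ.le, fun m hm => ?_⟩
  have hst : ∀ n, dist (c m n) (c m (n + 1)) ≤ K * σ ^ n := fun n => by
    rw [dist_comm, dist_eq_norm]
    exact hcau m hm n (n + 1) (Nat.le_succ n)
  have hcs : CauchySeq (c m) := cauchySeq_of_le_geometric σ K hσ1 hst
  obtain ⟨a, ha⟩ := cauchySeq_tendsto_of_complete hcs
  refine ⟨a, ha, fun n => ?_⟩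
  rw [← dist_eq_norm]
  calc dist (c m n) a ≤ K * σ ^ n / (1 - σ) := dist_le_of_le_geometric_of_tendsto σ K hσ1 hst ha n
    _ = K / (1 - σ) * σ ^ n := by ring

/-- `Mas05.L4`, preamble (p0013:L49–65) · **"`b_j - b_k = O(γ^{θj})` … and taking the limit `k → -∞` we get
`b_j = b + O(γ^{θj})`"**: a sequence in a complete space whose two-scale differences are geometrically small in the
LATER scale, `‖b n - b k‖ ≤ C·ρ^k` for `k ≤ n` (downward reading: `k` is the higher scale `j`, `n` the lower scale),
has a limit `b∞`, with the rate kept: `‖b k - b∞‖ ≤ C·ρ^k/(1-ρ)` for every `k`.  (The scale covariance of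
the trees that PRODUCES the hypothesis is the model's, GAP G-t8-1.)
[cite: Mastropietro2005, §5.2, the display before Lemma 4 (p0013:L44-65)] -/
theorem exists_limit_of_geometric_cauchy {F : Type*} [SeminormedAddCommGroup F] [CompleteSpace F]
    (b : ℕ → F) {ρ C : ℝ} (hρ1 : ρ < 1)
    (hcau : ∀ k n : ℕ, k ≤ n → ‖b n - b k‖ ≤ C * ρ ^ k) :
    ∃ binf : F, Tendsto b atTop (𝓝 binf) ∧ ∀ k, ‖b k - binf‖ ≤ C * ρ ^ k / (1 - ρ) := by
  have hst : ∀ n, dist (b n) (b (n + 1)) ≤ C * ρ ^ n := fun n => by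
    rw [dist_comm, dist_eq_norm]
    exact hcau n (n + 1) (Nat.le_succ n)
  obtain ⟨a, ha⟩ := cauchySeq_tendsto_of_complete (cauchySeq_of_le_geometric ρ C hρ1 hst)
  exact ⟨a, ha, fun k => by
    rw [← dist_eq_norm]
    exact dist_le_of_le_geometric_of_tendsto ρ C hρ1 hst ha k⟩

end Cauchy

/-! ## §C. The step of Lemma 4: `\Eq(5.78d)` at `n = n̄` ⇒ `\Eq(jgvvs)` ⇒ `b⃗_{n̄⃗} = 0` -/

section Step

variable {E : ℕ → Type*} [∀ m, NormedAddCommGroup (E m)] [∀ m, NormedSpace ℝ (E m)]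

/-- `Mas05.L4`, the inductive step · **A level whose lower levels are driftless and whose own coefficients stay
bounded has vanishing Beta coefficient.**  Hypotheses (the printed ones, read downwards with `σ² = γ^{-θ}`):
(i) every level `m < M` obeys `\Eq(5.78d)` with `\Eq(5.79a)` and no drift ("for all `n ≤ n̄-1`, `b⃗_{n⃗}` is
vanishing"): `‖c m (n+1) - c m n‖ ≤ D·Σ_{k<n}(σ²)^{n-k}Σ_{m'<m}‖c m' n - c m' k‖ + A·(σ²)ⁿ`; (ii) level `M` obeys the
"analogous of (5.78d) for `n = n̄`", `c⃗^{(j-1)}_{n̄⃗} = c⃗^{(j)}_{n̄⃗} + b⃗_{j,n̄⃗} + Σ_k d⃗^{n̄⃗}_{j,k}` with `b⃗_{j,n̄⃗} =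
b⃗_{n̄⃗} + O(γ^{θj})`: `‖c M (n+1) - c M n - b‖ ≤ D·Σ_{k<n}(σ²)^{n-k}Σ_{m'<M}‖c m' n - c m' k‖ + A·(σ²)ⁿ`; (iii) `‖c M n‖ ≤ B`
for every scale ("From Theorem 3 and Lemma 3 `v⃗^L_j` are analytic functions of `v⃗₁`" with coefficients bounded
uniformly in `j` — the content of Lemma 3).  Conclusion: `b = 0`.  Proof as printed: §B gives `\Eq(ind)`, hence the
right side of (ii) is `≤ K₁σⁿ` (`\Eq(ind 1)` ⇒ `\Eq(jgvvs)`), and §A.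
[cite: Mastropietro2005, §5.2 Lemma 4 and its proof, \Eq(1f), \Eq(5.78d), \Eq(ind 1), \Eq(jgvvs) (p0013:L69-117)] -/
theorem betaCoeff_eq_zero_of_bounded_flow (c : (m : ℕ) → ℕ → E m) {M : ℕ} (b : E M)
    {σ D A B : ℝ} (hσ0 : 0 ≤ σ) (hσ1 : σ < 1) (hD : 0 ≤ D) (hA : 0 ≤ A)
    (hrec : ∀ m < M, ∀ n, ‖c m (n + 1) - c m n‖ ≤
      D * ∑ k ∈ range n, (σ ^ 2) ^ (n - k) * ∑ m' ∈ range m, ‖c m' n - c m' k‖ +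
        A * (σ ^ 2) ^ n)
    (htop : ∀ n, ‖c M (n + 1) - c M n - b‖ ≤
      D * ∑ k ∈ range n, (σ ^ 2) ^ (n - k) * ∑ m' ∈ range M, ‖c m' n - c m' k‖ +
        A * (σ ^ 2) ^ n)
    (hbdd : ∀ n, ‖c M n‖ ≤ B) : b = 0 := by
  have h1σ : 0 < 1 - σ := by linarith
  obtain ⟨K, hK, hlow⟩ := coeff_cauchy_of_shortMemory c hσ0 hσ1 hD hA hrec
  have hK₁0 : 0 ≤ D * (M * K) * (1 - σ)⁻¹ + A :=
    add_nonneg (mul_nonneg (mul_nonneg hD (mul_nonneg (Nat.cast_nonneg M) hK))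
      (inv_nonneg.2 h1σ.le)) hA
  -- `\Eq(ind 1)` ⇒ `\Eq(jgvvs)`: the increments of level `M` are `b + O(σⁿ)`
  have he : ∀ n, ‖c M (n + 1) - c M n - b‖ ≤ (D * (M * K) * (1 - σ)⁻¹ + A) * σ ^ n := fun n =>
    (htop n).trans (shortMemoryRHS_le c hσ0 hσ1 hD hA hK hlow n)
  have hS : ∀ n, ∑ k ∈ range n, (D * (M * K) * (1 - σ)⁻¹ + A) * σ ^ k ≤
      (D * (M * K) * (1 - σ)⁻¹ + A) * (1 - σ)⁻¹ := by
    intro n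
    rw [← Finset.mul_sum]
    exact mul_le_mul_of_nonneg_left
      (sum_le_hasSum (range n) (fun i _ => pow_nonneg hσ0 i) (hasSum_geometric_of_lt_one hσ0 hσ1))
      hK₁0
  exact eq_zero_of_bounded_drift (c M) b (fun n => (D * (M * K) * (1 - σ)⁻¹ + A) * σ ^ n) he hS hbdd

/-! ## §D. Lemma 4, all orders: «`b⃗_{n⃗} = 0` for every `n⃗`» by least counterexample -/

/-- `Mas05.L4` · **Lemma 4 («vanishing of the reference model beta function»), its arithmetic in abstract form: a
coefficient flow that stays bounded at every level has ALL scale-invariant Beta coefficients equal to zero.**  Data: the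
Taylor-coefficient families `c m n : E m` of the flow (level `m` = total degree `n₁+n₂+n₃`, scale `j = -n`) and the
scale-invariant Beta coefficients `b m : E m` (print `b⃗_{n⃗}`, `|n⃗| = m`), `σ² = γ^{-θ}`.  Hypotheses — what the
reference model supplies (Theorem 3, Lemma 3, `b_{j,n⃗} = b_{n⃗} + O(γ^{θj})`, `\Eq(5.79a)`), kept abstract: (i) `‖c m n‖ ≤
B_m` uniformly in the scale, for every level; (ii) the SCHEMA of `\Eq(5.78d)`: for every level `M`, IF `b m = 0` for all
`m < M` THEN `‖c M (n+1) - c M n - b M‖ ≤ D_M·Σ_{k<n}(σ²)^{n-k}Σ_{m'<M}‖c m' n - c m' k‖ + A_M·(σ²)ⁿ` at every scale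
(nonnegative level-dependent constants).  Conclusion: `b m = 0` for every `m` — print's "assume that, for some `n̄⃗` …
`b⃗_{n̄⃗}` a non vanishing vector, and that for all `n ≤ n̄-1`, `b⃗_{n⃗}` is vanishing … this is a contradiction", run as a
strong induction on the level with `betaCoeff_eq_zero_of_bounded_flow` (constants made uniform over the finitely many
levels `≤ M` by summing them).  What is NOT proved: that the model `\equ(ll)` satisfies (i)–(ii) (GAP G-t8-1).
[cite: Mastropietro2005, §5.2 Lemma 4, \Eq(1f) (p0013:L69-117); Mastropietro2008, Ch. 13 (13.41)-(13.42), p0203] -/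
theorem lemma4_betaCoeff_eq_zero (c : (m : ℕ) → ℕ → E m) (b : (m : ℕ) → E m) {σ : ℝ}
    (D A B : ℕ → ℝ) (hσ0 : 0 ≤ σ) (hσ1 : σ < 1) (hD : ∀ m, 0 ≤ D m) (hA : ∀ m, 0 ≤ A m)
    (hbdd : ∀ m n, ‖c m n‖ ≤ B m)
    (hrec : ∀ M, (∀ m < M, b m = 0) → ∀ n, ‖c M (n + 1) - c M n - b M‖ ≤
      D M * ∑ k ∈ range n, (σ ^ 2) ^ (n - k) * ∑ m' ∈ range M, ‖c m' n - c m' k‖ +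
        A M * (σ ^ 2) ^ n) :
    ∀ m, b m = 0 := by
  intro M₀
  induction M₀ using Nat.strong_induction_on with
  | _ M ih =>
    -- uniform constants over the levels `≤ M`
    have hD' : ∀ m ≤ M, D m ≤ ∑ i ∈ range (M + 1), D i := fun m hm =>
      Finset.single_le_sum (fun i _ => hD i) (Finset.mem_range.2 (Nat.lt_succ_of_le hm))
    have hA' : ∀ m ≤ M, A m ≤ ∑ i ∈ range (M + 1), A i := fun m hm =>
      Finset.single_le_sum (fun i _ => hA i) (Finset.mem_range.2 (Nat.lt_succ_of_le hm))
    have hD'0 : 0 ≤ ∑ i ∈ range (M + 1), D i := Finset.sum_nonneg fun i _ => hD i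
    have hA'0 : 0 ≤ ∑ i ∈ range (M + 1), A i := Finset.sum_nonneg fun i _ => hA i
    -- the recursion at the levels `m ≤ M`, with the uniform constants
    have hrec' : ∀ m ≤ M, ∀ n, ‖c m (n + 1) - c m n - b m‖ ≤
        (∑ i ∈ range (M + 1), D i) *
            ∑ k ∈ range n, (σ ^ 2) ^ (n - k) * ∑ m' ∈ range m, ‖c m' n - c m' k‖ +
          (∑ i ∈ range (M + 1), A i) * (σ ^ 2) ^ n := by
      intro m hm n
      have hz : ∀ m' < m, b m' = 0 := fun m' hm' => ih m' (lt_of_lt_of_le hm' hm)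
      refine (hrec m hz n).trans (add_le_add ?_ ?_)
      · exact mul_le_mul_of_nonneg_right (hD' m hm) (Finset.sum_nonneg fun k _ =>
          mul_nonneg (pow_nonneg (sq_nonneg σ) _) (Finset.sum_nonneg fun _ _ => norm_nonneg _))
      · exact mul_le_mul_of_nonneg_right (hA' m hm) (pow_nonneg (sq_nonneg σ) n)
    -- lower levels: no drift
    have hlow : ∀ m < M, ∀ n, ‖c m (n + 1) - c m n‖ ≤
        (∑ i ∈ range (M + 1), D i) *
            ∑ k ∈ range n, (σ ^ 2) ^ (n - k) * ∑ m' ∈ range m, ‖c m' n - c m' k‖ +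
          (∑ i ∈ range (M + 1), A i) * (σ ^ 2) ^ n := by
      intro m hm n
      have h := hrec' m hm.le n
      rwa [ih m hm, sub_zero] at h
    exact betaCoeff_eq_zero_of_bounded_flow c (b M) hσ0 hσ1 hD'0 hA'0 hlow (hrec' M le_rfl) (hbdd M)

end Step

end Mastropietro2005

end Literature.MathematicalPhysics.QuantumLattice.FermiRG
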